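import Mathlib
import Summits.ValiantsHypothesis.ValiantsHypothesis.Theorems.DivisionGapPerMultiplesHardOrderedFactorCounts

/-!
# `DivisionGap.PerMultiplesHard` (stmt-ValiantsHypothesis-5068), line `uncharged-face-walk`:
the ORDERED FACTOR, part 2 of 5 — the FIRST MOMENT over the `a!` orders (lead c8, cycle 8)

`exists_good_order`: for a block `X` all of whose columns have degree `≥ a/D₁` (and the arithmetic hypothesis of
`col_count`), some order `ρ` has SIMULTANEOUSLY `#bad X t ρ < 8(Bpairs/(a−1) + 1)` (`Bpairs` = ordered row pairs of
codegree `< t`), `dev₁ < 8(Dev₂/(a−1) + 1)` (`dev₁` = `ℓ¹` deviation of the consecutive codegrees from `c₂`, `Dev₂` = the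
same over all ordered pairs), `dev₂ < 8(a·Dev₄/((a−1)(a−2)(a−3)) + 1)` (4-wise intersections along non-adjacent position
pairs vs. all ordered quadruples), and EVERY column with at least `a/(64D₁⁴)` consecutive pairs inside its
neighbourhood.  Proof: the means of the three statistics are computed by `sum_perm_pairs` / `sum_perm_quads`
(`Σ_k #nonAdj k ≤ a²`, `a!/(a−4)! = a(a−1)(a−2)(a−3)`), the deficient columns have total mass `≤ a!/4` by `col_count`,
and `exists_good_index` selects the order. Elementary. [folklore]
-/

noncomputable section

-- `Summit.ValiantsHypothesis.ValiantsHypothesis.…` is the tree's mandated layout (Sub = Summit).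
set_option linter.dupNamespace false

open Finset
open scoped BigOperators

namespace Summit.ValiantsHypothesis.ValiantsHypothesis.Theorems.DivisionGap.PerMultiplesHard.OrderedFactor

variable {a : ℕ}

/-- **First moment.**  Some order has few bad positions, small deviation statistics, and every column with at
least `a/(64 D₁⁴)` consecutive pairs inside its neighbourhood. -/
lemma exists_good_order (X : Finset (Fin a × Fin a)) (D₁ a₀ : ℕ)
    (harith : ∀ a' ≥ a₀, ∀ d : ℕ, a' ≤ D₁ * d → d ≤ a' →
      4 * a' * (∑ w' ∈ Finset.range (a' / (64 * D₁ ^ 4)), a'.choose w' * (a' + 1 - (d - w')).choose (d - w')) ≤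
        a'.choose d)
    (ha₀ : a₀ ≤ a) (ha : 4 ≤ a) (t : ℕ) (c₂ c₄ : ℝ)
    (hcol : ∀ y : Fin a, a ≤ D₁ * (Finset.univ.filter fun x : Fin a => (x, y) ∈ X).card) :
    ∃ ρ : Equiv.Perm (Fin a),
      (((Finset.univ.filter fun kk : Fin a => (Finset.univ.filter fun yy : Fin a => (ρ kk, yy) ∈ X ∧ (ρ ((finRotate a).symm kk), yy) ∈ X).card < t)).card : ℝ) < 8 * ((∑ x : Fin a, ∑ x' ∈ Finset.univ.erase x, (if (Finset.univ.filter fun yy : Fin a => (x, yy) ∈ X ∧ (x', yy) ∈ X).card < t then (1 : ℝ) else 0)) / (a - 1) + 1) ∧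
      (∑ k : Fin a, |((((Finset.univ.filter fun yy : Fin a => (ρ k, yy) ∈ X ∧ (ρ ((finRotate a).symm k), yy) ∈ X).card) : ℕ) : ℝ) - c₂|) < 8 * ((∑ x : Fin a, ∑ x' ∈ Finset.univ.erase x, |(((Finset.univ.filter fun yy : Fin a => (x, yy) ∈ X ∧ (x', yy) ∈ X).card : ℕ) : ℝ) - c₂|) / (a - 1) + 1) ∧
      (∑ k : Fin a, ∑ k' ∈ (((Finset.univ.erase k).erase ((finRotate a).symm k)).erase (finRotate a k)), |((((Finset.univ.filter fun yy : Fin a => (ρ k, yy) ∈ X ∧ (ρ ((finRotate a).symm k), yy) ∈ X ∧ (ρ k', yy) ∈ X ∧ (ρ ((finRotate a).symm k'), yy) ∈ X).card) : ℕ) : ℝ) - c₄|) < 8 * ((a : ℝ) * (∑ x₁ : Fin a, ∑ x₂ ∈ Finset.univ.erase x₁, ∑ x₃ ∈ (Finset.univ.erase x₁).erase x₂, ∑ x₄ ∈ ((Finset.univ.erase x₁).erase x₂).erase x₃, |(((Finset.univ.filter fun yy : Fin a => (x₁, yy) ∈ X ∧ (x₂, yy) ∈ X ∧ (x₃, yy)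 ∈ X ∧ (x₄, yy) ∈ X).card : ℕ) : ℝ) - c₄|) / ((a - 1) * (a - 2) * (a - 3)) + 1) ∧
      ∀ y : Fin a, a / (64 * D₁ ^ 4) ≤ ((Finset.univ.filter fun kk : Fin a => (ρ kk, y) ∈ X ∧ (ρ ((finRotate a).symm kk), y) ∈ X).card) := by
  classical
  have ha2 : 2 ≤ a := by omega
  set w := a / (64 * D₁ ^ 4) with hw
  -- the four statistics
  let f₁ : Equiv.Perm (Fin a) → ℝ := fun ρ => (((Finset.univ.filter fun kk : Fin a => (Finset.univ.filter fun yy : Fin a => (ρ kk, yy) ∈ X ∧ (ρ ((finRotate a).symm kk), yy) ∈ X).card < t)).card : ℝ)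
  let f₄ : Equiv.Perm (Fin a) → ℕ := fun ρ => (Finset.univ.filter fun y : Fin a => ((Finset.univ.filter fun kk : Fin a => (ρ kk, y) ∈ X ∧ (ρ ((finRotate a).symm kk), y) ∈ X).card) < w).card
  have hcard : (Fintype.card (Equiv.Perm (Fin a)) : ℝ) = (a.factorial : ℝ) := by
    rw [Fintype.card_perm, Fintype.card_fin]
  -- column union bound
  have h₄ : 4 * ∑ ρ : Equiv.Perm (Fin a), f₄ ρ ≤ Fintype.card (Equiv.Perm (Fin a)) := by
    rw [Fintype.card_perm, Fintype.card_fin]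
    have hswap : ∑ ρ : Equiv.Perm (Fin a), f₄ ρ =
        ∑ y : Fin a, ((Finset.univ : Finset (Equiv.Perm (Fin a))).filter (fun ρ => ((Finset.univ.filter fun kk : Fin a => (ρ kk, y) ∈ X ∧ (ρ ((finRotate a).symm kk), y) ∈ X).card) < w)).card := by
      simp only [f₄, Finset.card_filter]
      exact Finset.sum_comm
    rw [hswap, Finset.mul_sum]
    have hapos : 0 < a := by omega
    have key : ∀ y : Fin a, a * (4 * ((Finset.univ : Finset (Equiv.Perm (Fin a))).filter
        (fun ρ => ((Finset.univ.filter fun kk : Fin a => (ρ kk, y) ∈ X ∧ (ρ ((finRotate a).symm kk), y) ∈ X).card) < w)).card) ≤ a.factorial := by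
      intro y
      have := col_count X D₁ a₀ harith ha₀ y (hcol y)
      rw [← hw] at this
      linarith [this]
    have : a * ∑ y : Fin a, 4 * ((Finset.univ : Finset (Equiv.Perm (Fin a))).filter
        (fun ρ => ((Finset.univ.filter fun kk : Fin a => (ρ kk, y) ∈ X ∧ (ρ ((finRotate a).symm kk), y) ∈ X).card) < w)).card ≤ a * a.factorial := by
      rw [Finset.mul_sum]
      calc ∑ y : Fin a, a * (4 * ((Finset.univ : Finset (Equiv.Perm (Fin a))).filter
              (fun ρ => ((Finset.univ.filter fun kk : Fin a => (ρ kk, y) ∈ X ∧ (ρ ((finRotate a).symm kk), y) ∈ X).card) < w)).card)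
          ≤ ∑ _y : Fin a, a.factorial := Finset.sum_le_sum fun y _ => key y
        _ = a * a.factorial := by simp
    exact Nat.le_of_mul_le_mul_left this hapos
  obtain ⟨ρ, hρ₁, hρ₂, hρ₃, hρ₄⟩ := exists_good_index f₁ (fun σσ => (∑ k : Fin a, |((((Finset.univ.filter fun yy : Fin a => (σσ k, yy) ∈ X ∧ (σσ ((finRotate a).symm k), yy) ∈ X).card) : ℕ) : ℝ) - c₂|)) (fun σσ => (∑ k : Fin a, ∑ k' ∈ (((Finset.univ.erase k).erase ((finRotate a).symm k)).erase (finRotate a k)), |((((Finset.univ.filter fun yy : Fin a => (σσ k, yy) ∈ X ∧ (σσ ((finRotate a).symm k), yy) ∈ X ∧ (σσ k', yy) ∈ X ∧ (σσ ((finRotate a).symm k'), yy) ∈ X).card) : ℕ) : ℝ) - c₄|)) f₄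
    (fun ρ => by positivity)
    (fun ρ => Finset.sum_nonneg fun _ _ => abs_nonneg _)
    (fun ρ => Finset.sum_nonneg fun _ _ => Finset.sum_nonneg fun _ _ => abs_nonneg _) h₄
  refine ⟨ρ, ?_, ?_, ?_, ?_⟩
  · -- bad pairs
    have hsum : ∑ ρ' : Equiv.Perm (Fin a), f₁ ρ' = (a : ℝ) * ((a - 2).factorial : ℝ) * (∑ x : Fin a, ∑ x' ∈ Finset.univ.erase x, (if (Finset.univ.filter fun yy : Fin a => (x, yy) ∈ X ∧ (x', yy) ∈ X).card < t then (1 : ℝ) else 0)) := by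
      have : ∀ ρ' : Equiv.Perm (Fin a), f₁ ρ' =
          ∑ k : Fin a, (if ((Finset.univ.filter fun yy : Fin a => ((ρ' k), yy) ∈ X ∧ ((ρ' (((finRotate a).symm k))), yy) ∈ X).card) < t then (1 : ℝ) else 0) := by
        intro ρ'
        simp only [f₁, Finset.card_filter]
        push_cast
        rfl
      simp only [this]
      exact sum_perm_pairs ha2 (fun x x' => if ((Finset.univ.filter fun yy : Fin a => (x, yy) ∈ X ∧ (x', yy) ∈ X).card) < t then (1 : ℝ) else 0)
    rw [hsum, hcard] at hρ₁
    convert hρ₁ using 3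
    have hfac : (a.factorial : ℝ) = (a : ℝ) * ((a : ℝ) - 1) * ((a - 2).factorial : ℝ) := by
      obtain ⟨m, rfl⟩ : ∃ m, a = m + 2 := ⟨a - 2, by omega⟩
      simp [Nat.factorial_succ]
      ring
    rw [hfac]
    have h1 : (a : ℝ) - 1 ≠ 0 := by
      have : (2 : ℝ) ≤ a := by exact_mod_cast ha2
      linarith
    have h2 : (a : ℝ) ≠ 0 := by positivity
    have h3 : ((a - 2).factorial : ℝ) ≠ 0 := by positivity
    field_simp
  · -- dev₁
    have hsum : ∑ ρ' : Equiv.Perm (Fin a), (∑ k : Fin a, |((((Finset.univ.filter fun yy : Fin a => (ρ' k, yy) ∈ X ∧ (ρ' ((finRotate a).symm k), yy) ∈ X).card) : ℕ) : ℝ) - c₂|) = (a : ℝ) * ((a - 2).factorial : ℝ) * (∑ x : Fin a, ∑ x' ∈ Finset.univ.erase x, |(((Finset.univ.filter fun yy : Fin a => (x, yy) ∈ X ∧ (x', yy) ∈ X).card : ℕ) : ℝ) - c₂|) :=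
      sum_perm_pairs ha2 (fun x x' => |(((Finset.univ.filter fun yy : Fin a => (x, yy) ∈ X ∧ (x', yy) ∈ X).card) : ℝ) - c₂|)
    rw [hsum, hcard] at hρ₂
    convert hρ₂ using 3
    have hfac : (a.factorial : ℝ) = (a : ℝ) * ((a : ℝ) - 1) * ((a - 2).factorial : ℝ) := by
      obtain ⟨m, rfl⟩ : ∃ m, a = m + 2 := ⟨a - 2, by omega⟩
      simp [Nat.factorial_succ]
      ring
    rw [hfac]
    have h1 : (a : ℝ) - 1 ≠ 0 := by
      have : (2 : ℝ) ≤ a := by exact_mod_cast ha2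
      linarith
    have h2 : (a : ℝ) ≠ 0 := by positivity
    have h3 : ((a - 2).factorial : ℝ) ≠ 0 := by positivity
    field_simp
  · -- dev₂
    have hsum : ∑ ρ' : Equiv.Perm (Fin a), (∑ k : Fin a, ∑ k' ∈ (((Finset.univ.erase k).erase ((finRotate a).symm k)).erase (finRotate a k)), |((((Finset.univ.filter fun yy : Fin a => (ρ' k, yy) ∈ X ∧ (ρ' ((finRotate a).symm k), yy) ∈ X ∧ (ρ' k', yy) ∈ X ∧ (ρ' ((finRotate a).symm k'), yy) ∈ X).card) : ℕ) : ℝ) - c₄|) =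
        (∑ k : Fin a, (((((Finset.univ.erase k).erase ((finRotate a).symm k)).erase (finRotate a k))).card : ℝ)) * ((a - 4).factorial : ℝ) * (∑ x₁ : Fin a, ∑ x₂ ∈ Finset.univ.erase x₁, ∑ x₃ ∈ (Finset.univ.erase x₁).erase x₂, ∑ x₄ ∈ ((Finset.univ.erase x₁).erase x₂).erase x₃, |(((Finset.univ.filter fun yy : Fin a => (x₁, yy) ∈ X ∧ (x₂, yy) ∈ X ∧ (x₃, yy) ∈ X ∧ (x₄, yy) ∈ X).card : ℕ) : ℝ) - c₄|) :=
      sum_perm_quads ha2 (fun x₁ x₂ x₃ x₄ => |(((Finset.univ.filter fun yy : Fin a => (x₁, yy) ∈ X ∧ (x₂, yy) ∈ X ∧ (x₃, yy) ∈ X ∧ (x₄, yy) ∈ X).card) : ℝ) - c₄|)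
    rw [hsum, hcard] at hρ₃
    refine lt_of_lt_of_le hρ₃ ?_
    have hfac : (a.factorial : ℝ) =
        (a : ℝ) * ((a : ℝ) - 1) * ((a : ℝ) - 2) * ((a : ℝ) - 3) * ((a - 4).factorial : ℝ) := by
      obtain ⟨m, rfl⟩ : ∃ m, a = m + 4 := ⟨a - 4, by omega⟩
      simp [Nat.factorial_succ]
      ring
    have hN : (∑ k : Fin a, (((((Finset.univ.erase k).erase ((finRotate a).symm k)).erase (finRotate a k))).card : ℝ)) ≤ (a : ℝ) * a := by
      calc (∑ k : Fin a, (((((Finset.univ.erase k).erase ((finRotate a).symm k)).erase (finRotate a k))).card : ℝ)) ≤ ∑ _k : Fin a, (a : ℝ) :=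
            Finset.sum_le_sum fun k _ => by exact_mod_cast card_nonAdj_le k
        _ = (a : ℝ) * a := by simp
    have hN0 : 0 ≤ ∑ k : Fin a, (((((Finset.univ.erase k).erase ((finRotate a).symm k)).erase (finRotate a k))).card : ℝ) := Finset.sum_nonneg fun _ _ => by positivity
    have hD0 : 0 ≤ (∑ x₁ : Fin a, ∑ x₂ ∈ Finset.univ.erase x₁, ∑ x₃ ∈ (Finset.univ.erase x₁).erase x₂, ∑ x₄ ∈ ((Finset.univ.erase x₁).erase x₂).erase x₃, |(((Finset.univ.filter fun yy : Fin a => (x₁, yy) ∈ X ∧ (x₂, yy) ∈ X ∧ (x₃, yy) ∈ X ∧ (x₄, yy) ∈ X).card : ℕ) : ℝ) - c₄|) := Finset.sum_nonneg fun _ _ => Finset.sum_nonneg fun _ _ =>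
      Finset.sum_nonneg fun _ _ => Finset.sum_nonneg fun _ _ => abs_nonneg _
    have ha' : (4 : ℝ) ≤ a := by exact_mod_cast ha
    have h1 : 0 < (a : ℝ) - 1 := by linarith
    have h2 : 0 < (a : ℝ) - 2 := by linarith
    have h3 : 0 < (a : ℝ) - 3 := by linarith
    have hpos : 0 < ((a : ℝ) - 1) * ((a : ℝ) - 2) * ((a : ℝ) - 3) := mul_pos (mul_pos h1 h2) h3
    have hf0 : 0 < ((a - 4).factorial : ℝ) := by positivity
    gcongr 8 * (?_ + 1)
    rw [div_le_div_iff₀ (by positivity) hpos, hfac]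
    have := mul_le_mul_of_nonneg_right hN (mul_nonneg hf0.le hD0)
    nlinarith [this]
  · intro y
    by_contra hy
    have hy' : ((Finset.univ.filter fun kk : Fin a => (ρ kk, y) ∈ X ∧ (ρ ((finRotate a).symm kk), y) ∈ X).card) < w := not_le.mp hy
    have : y ∈ (Finset.univ.filter fun y : Fin a => ((Finset.univ.filter fun kk : Fin a => (ρ kk, y) ∈ X ∧ (ρ ((finRotate a).symm kk), y) ∈ X).card) < w) :=
      Finset.mem_filter.mpr ⟨Finset.mem_univ _, hy'⟩
    have hpos : 0 < f₄ ρ := Finset.card_pos.mpr ⟨y, this⟩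
    omega


/-! ### The composition -/

/-- `Bpairs` is the number of ordered bad pairs. -/
lemma Bpairs_eq (X : Finset (Fin a × Fin a)) (t : ℕ) :
    (∑ x : Fin a, ∑ x' ∈ Finset.univ.erase x, (if (Finset.univ.filter fun yy : Fin a => (x, yy) ∈ X ∧ (x', yy) ∈ X).card < t then (1 : ℝ) else 0)) = ∑ x : Fin a, ((Finset.univ.filter fun y : Fin a => y ≠ x ∧ ((Finset.univ.filter fun yy : Fin a => (x, yy) ∈ X ∧ (y, yy) ∈ X).card) < t).card : ℝ) := by
  refine Finset.sum_congr rfl fun x _ => ?_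
  rw [Finset.sum_boole]
  congr 2
  ext y
  simp [Finset.mem_filter, Finset.mem_erase]

/-- **Registered corollary of `exists_good_order` (ordered factor, part 2).**  If every column of the block has degree
`≥ a/D₁` (and the binomial arithmetic of `stub_columnRunsArith` holds from `a₀` on), some cyclic order of the rows gives
EVERY column at least `a/(64 D₁⁴)` consecutive pairs inside its neighbourhood. [folklore] -/
theorem orderedFactor_noDeficientColumn :
    ∀ (a : ℕ) (X : Finset (Fin a × Fin a)) (D₁ a₀ : ℕ), (∀ a' ≥ a₀, ∀ d : ℕ, a' ≤ D₁ * d → d ≤ a' → 4 * a' * (∑ w' ∈ Finset.range (a' / (64 * D₁ ^ 4)), a'.choose w' * (a' + 1 - (d - w')).choose (d - w')) ≤ a'.choose d) → a₀ ≤ a → 4 ≤ a → (∀ y : Fin a, a ≤ D₁ * (Finset.univ.filter fun x : Fin a => (x, y) ∈ X).card) → ∃ ρ : Equiv.Perm (Fin a), ∀ y : Fin a, a / (64 * D₁ ^ 4) ≤ (Finset.univ.filter fun kk : Fin a => (ρ kk, y) ∈ X ∧ (ρ ((finRotate a).symm kk), y) ∈ X).card := by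
  intro a X D₁ a₀ harith ha₀ ha hcol
  obtain ⟨ρ, -, -, -, h⟩ := exists_good_order X D₁ a₀ harith ha₀ ha 0 0 0 hcol
  exact ⟨ρ, h⟩

end Summit.ValiantsHypothesis.ValiantsHypothesis.Theorems.DivisionGap.PerMultiplesHard.OrderedFactor

end
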